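import Summits.SmoothPoincare4.SmoothPoincare4.Theorems.CylinderEntropySliceIsolationStubCertHigh
import Literature.Geometry.Riemannian.SphericalZonalGaussianBounds
import Mathlib
import HarnessLib

/-!
# Certificate for the conformal kernel domination on `10 ≤ T ≤ 100` — elementary tools (aux file 1/2 of `stub_certHigh2`)

Auxiliary file of the registered stub `stub_certHigh2` (line `conformal-kernel-domination`, crux
`Summit.SmoothPoincare4.SmoothPoincare4.Theses.CylinderEntropy.SliceIsolation`, item stmt-SmoothPoincare4-7632); the
certificate itself is `CylinderEntropySliceIsolationStubCertHigh2.lean`, its polynomial cells are in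
`CylinderEntropySliceIsolationStubCertHigh2Cells.lean`.  Normalised variables (as in the landed `stub_certHigh`):
`b = √(2/T) ∈ [707/5000, 4473/10000]`, `x = eᵘ b/4` (so `ρ = x²` and the peak is at `x ≈ 1`), `s ∈ [−1, 1]`; the
pulled-back kernel is `Λ₄ e^{−b²/8} G(x) e^{bxs}`, `G(x) = x⁴ e^{2−2x²}`, and the certificate is the flat atom plus TWO
cylinder kernels of the dyadic scales `τ₁ = (log 2)/2`, `τ₂ = log 2` centred at the peak height `σ = ½ log(8T)`, whose
height Gaussians are `E₁(x) = exp(−(log x)²/(2 log 2))`, `E₂(x) = exp(−(log x)²/(4 log 2))`.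
This file provides: the quartic upper bound `e^y ≤ Q₄(y) := 1 + y + y²/2 + y³/6 + (19/375) y⁴` (`|y| ≤ 9/10`) and its
chord inequality (convexity in the dipole size `b`); the quartic minorant `P₁ ≤ 𝔥((log 2)/2, ·)` (eleven dyadic terms of
the Gegenbauer series, the terms `k = 5, …, 10` and the geometric tail absorbed into `−1/8192`); polynomial bounds for
`(log x)²` on cells and the resulting minorants `1 − κU ≤ E₂`, `1 − 2κU ≤ E₁` (`κ = 3607/10000 ≥ 1/(4 log 2)`); the
reduction of `G ≤ Ĝ` (quadratic `Ĝ`) to a polynomial inequality; the far regions `x ≤ 7/20`, `x ≥ 2` (flat atom alone);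
the assembly of one cell; and the mass bound.  No definitions, no named facts.
-/

noncomputable section

-- the registered namespace `Summit.SmoothPoincare4.SmoothPoincare4.Theorems…` repeats a component
set_option linter.dupNamespace false

namespace Summit.SmoothPoincare4.SmoothPoincare4.Theorems.CylinderEntropySliceIsolation

open Literature.Geometry.Riemannian Literature.Geometry.Riemannian.SphericalCylinderEntropy
open Literature.Geometry.Riemannian.SphericalZonalKernelSeries (zonal_nonneg partialSum_sub_geometric_le_zonal)

/-! ### The quartic bound of the dipole factor and its convexity in `b` -/

/-- `e^y ≤ Q₄(y) = 1 + y + y²/2 + y³/6 + (19/375) y⁴` for `|y| ≤ 9/10` (`Real.exp_bound` with five terms,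
`|y|⁵ ≤ (9/10) y⁴`, `1/24 + 9/1000 = 19/375`). [folklore] -/
theorem certHigh2_exp_le_Q4 {y : ℝ} (hy : |y| ≤ 9 / 10) :
    Real.exp y ≤ 1 + y + y ^ 2 / 2 + y ^ 3 / 6 + 19 / 375 * y ^ 4 := by
  have hy1 : |y| ≤ 1 := hy.trans (by norm_num)
  have h := Real.exp_bound hy1 (n := 5) (by norm_num)
  simp only [Finset.sum_range_succ, Finset.sum_range_zero, Nat.factorial] at h
  norm_num at h
  have h2 := (abs_le.1 h).2
  have hy5 : |y| ^ 5 ≤ 9 / 10 * y ^ 4 := by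
    have h3 : |y| ^ 5 = y ^ 4 * |y| := by
      rw [pow_succ, Even.pow_abs (by norm_num : Even 4)]
    rw [h3]
    nlinarith [pow_nonneg (sq_nonneg y) 2, abs_nonneg y]
  nlinarith [h2, hy5]

/-- Chord inequality for the convex quartic `Q₄` between two points of `[-1, 1]`:
`Q₄((1−λ) y₀ + λ y₁) ≤ (1−λ) Q₄(y₀) + λ Q₄(y₁)` (the second divided difference of `Q₄` is
`1/2 + (y₀+y₁+y)/6 + (19/375)(y₀² + y₁² + y² + y₀y₁ + y₀y + y₁y) ≥ 0`). [folklore] -/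
theorem certHigh2_Q4_chord {y₀ y₁ l : ℝ} (hl0 : 0 ≤ l) (hl1 : l ≤ 1) (h0 : |y₀| ≤ 1) (h1 : |y₁| ≤ 1) :
    1 + ((1 - l) * y₀ + l * y₁) + ((1 - l) * y₀ + l * y₁) ^ 2 / 2 + ((1 - l) * y₀ + l * y₁) ^ 3 / 6 +
        19 / 375 * ((1 - l) * y₀ + l * y₁) ^ 4 ≤
      (1 - l) * (1 + y₀ + y₀ ^ 2 / 2 + y₀ ^ 3 / 6 + 19 / 375 * y₀ ^ 4) +
        l * (1 + y₁ + y₁ ^ 2 / 2 + y₁ ^ 3 / 6 + 19 / 375 * y₁ ^ 4) := by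
  set y := (1 - l) * y₀ + l * y₁ with hy
  have hy1 : |y| ≤ 1 := by
    rw [abs_le] at h0 h1 ⊢
    constructor <;> nlinarith [mul_nonneg hl0 (sub_nonneg.2 hl1)]
  have key : (1 - l) * (1 + y₀ + y₀ ^ 2 / 2 + y₀ ^ 3 / 6 + 19 / 375 * y₀ ^ 4) +
      l * (1 + y₁ + y₁ ^ 2 / 2 + y₁ ^ 3 / 6 + 19 / 375 * y₁ ^ 4) -
      (1 + y + y ^ 2 / 2 + y ^ 3 / 6 + 19 / 375 * y ^ 4) =
      l * (1 - l) * (y₁ - y₀) ^ 2 * (1 / 2 + (y₀ + y₁ + y) / 6 +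
        19 / 375 * ((y₀ + y₁) ^ 2 + (y₀ + y) ^ 2 + (y₁ + y) ^ 2) / 2) := by
    rw [hy]; ring
  have hD : 0 ≤ 1 / 2 + (y₀ + y₁ + y) / 6 +
      19 / 375 * ((y₀ + y₁) ^ 2 + (y₀ + y) ^ 2 + (y₁ + y) ^ 2) / 2 := by
    rw [abs_le] at h0 h1 hy1
    nlinarith [sq_nonneg (y₀ + y₁), sq_nonneg (y₀ + y), sq_nonneg (y₁ + y)]
  nlinarith [mul_nonneg (mul_nonneg (mul_nonneg hl0 (sub_nonneg.2 hl1)) (sq_nonneg (y₁ - y₀))) hD]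

/-! ### The quartic minorant of the zonal kernel at `τ = (log 2)/2` -/

/-- The terms `k = 5, …, 10` of the dyadic series at `q = 1/2` dominate the absorbed constant:
`Σ_{k=5}^{10} 2^{-k(k+3)/2} (2k+3)/3 · C_k(s) + 1/8192 − (1/4)^{11}/(3/4) ≥ 0` on `[-1, 1]`, as the explicit
degree-10 polynomial (Bernstein coefficients on `[-1, 1]` positive). [folklore] -/
theorem certHigh2_zonal_half_piece (s : ℝ) (hs1 : -1 ≤ s) (hs2 : s ≤ 1) :
    0 ≤ 3447448365250363837 / 28334198897217871282176 + 125061960851135 / 2305843009213693952 * s +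
      20780401589306625 / 9444732965739290427392 * s ^ 2 - 187583582804625 / 576460752303423488 * s ^ 3 -
      38096881332148485 / 4722366482869645213696 * s ^ 4 + 412622116515609 / 1152921504606846976 * s ^ 5 +
      33015941043950865 / 4722366482869645213696 * s ^ 6 + 38235558075 / 576460752303423488 * s ^ 7 +
      2905944676635 / 9444732965739290427392 * s ^ 8 + 1616615 / 2305843009213693952 * s ^ 9 +
      7436429 / 9444732965739290427392 * s ^ 10 := by
  have ha : (0 : ℝ) ≤ s - (-1) := by linarith
  have hb : (0 : ℝ) ≤ 1 - s := by linarith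
  linarith [pow_nonneg hb 10, mul_nonneg (pow_nonneg ha 1) (pow_nonneg hb 9),
    mul_nonneg (pow_nonneg ha 2) (pow_nonneg hb 8), mul_nonneg (pow_nonneg ha 3) (pow_nonneg hb 7),
    mul_nonneg (pow_nonneg ha 4) (pow_nonneg hb 6), mul_nonneg (pow_nonneg ha 5) (pow_nonneg hb 5),
    mul_nonneg (pow_nonneg ha 6) (pow_nonneg hb 4), mul_nonneg (pow_nonneg ha 7) (pow_nonneg hb 3),
    mul_nonneg (pow_nonneg ha 8) (pow_nonneg hb 2), mul_nonneg (pow_nonneg ha 9) (pow_nonneg hb 1),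
    pow_nonneg ha 10]

/-- **Quartic minorant of the zonal kernel at `τ = (log 2)/2`**:
`P₁(s) := 116775/131072 + (1235/1024) s + (35455/65536) s² + (105/1024) s³ + (1155/131072) s⁴ ≤ 𝔥((log 2)/2, s)`
on `[-1, 1]` (the first five terms of the series, whose weights are `2^{-k(k+3)/2} (2k+3)/3`, minus `1/8192`;
from the tree's `partialSum_sub_geometric_le_zonal` with `q = 1/2`, `K = 10`). [folklore] -/
theorem certHigh2_zonal_half_lower {s : ℝ} (hs1 : -1 ≤ s) (hs2 : s ≤ 1) :
    116775 / 131072 + 1235 / 1024 * s + 35455 / 65536 * s ^ 2 + 105 / 1024 * s ^ 3 +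
        1155 / 131072 * s ^ 4 ≤ zonal (Real.log 2 / 2) s := by
  have hs : |s| ≤ 1 := abs_le.2 ⟨hs1, hs2⟩
  have h := partialSum_sub_geometric_le_zonal (q := 1 / 2) (by norm_num) (by norm_num) 10 hs
    (by norm_num)
  have hlog : -Real.log (1 / 2) / 2 = Real.log 2 / 2 := by
    rw [one_div, Real.log_inv, neg_neg]
  rw [hlog] at h
  simp only [Finset.sum_range_succ, Finset.sum_range_zero, gegen, Finset.prod_range_succ,
    Finset.prod_range_zero, Nat.factorial] at h
  norm_num at h
  have hp := certHigh2_zonal_half_piece s hs1 hs2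
  linarith

/-- `P₁ ≥ 0` on `[-1, 1]`. [folklore] -/
theorem certHigh2_P1_nonneg {s : ℝ} (hs1 : -1 ≤ s) (hs2 : s ≤ 1) :
    0 ≤ 116775 / 131072 + 1235 / 1024 * s + 35455 / 65536 * s ^ 2 + 105 / 1024 * s ^ 3 +
      1155 / 131072 * s ^ 4 := by
  have ha : (0 : ℝ) ≤ s - (-1) := by linarith
  have hb : (0 : ℝ) ≤ 1 - s := by linarith
  linarith [pow_nonneg hb 4, mul_nonneg (pow_nonneg ha 1) (pow_nonneg hb 3),
    mul_nonneg (pow_nonneg ha 2) (pow_nonneg hb 2), mul_nonneg (pow_nonneg ha 3) (pow_nonneg hb 1),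
    pow_nonneg ha 4]

/-! ### Polynomial bounds for `(log x)²` on the cells and the height Gaussians -/

/-- Cells right of the peak, `1 ≤ x ≤ c < 2`:
`(log x)² ≤ ((x−1) − (x−1)²/2 + c₃ (x−1)³)²` for `c₃ ≥ 1/3 + (c−1)/(2−c)`
(`Real.abs_log_sub_add_sum_range_le` with three terms, `(x−1)⁴/(2−x) ≤ (x−1)³ (c−1)/(2−c)`). [folklore] -/
theorem certHigh2_logsq_plus {x c c₃ : ℝ} (h1 : 1 ≤ x) (h2 : x ≤ c) (hc : c < 2)
    (hc₃ : 1 / 3 + (c - 1) / (2 - c) ≤ c₃) :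
    Real.log x ^ 2 ≤ ((x - 1) - (x - 1) ^ 2 / 2 + c₃ * (x - 1) ^ 3) ^ 2 := by
  have hy : |1 - x| < 1 := by rw [abs_sub_comm, abs_of_nonneg (by linarith)]; linarith
  have h := Real.abs_log_sub_add_sum_range_le hy 3
  simp only [Finset.sum_range_succ, Finset.sum_range_zero] at h
  norm_num at h
  rw [abs_sub_comm, abs_of_nonneg (by linarith : (0 : ℝ) ≤ x - 1)] at h
  have hup := (abs_le.1 h).2
  have h2c : 0 < 2 - c := by linarith
  have h2x : 0 < 2 - x := by linarith
  have hfrac : (x - 1) ^ 4 / (1 - (x - 1)) ≤ (c - 1) / (2 - c) * (x - 1) ^ 3 := by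
    rw [show (1 : ℝ) - (x - 1) = 2 - x by ring, div_le_iff₀ h2x, div_mul_eq_mul_div, div_mul_eq_mul_div,
      le_div_iff₀ h2c]
    have h3 : 0 ≤ (x - 1) ^ 3 := pow_nonneg (by linarith) 3
    nlinarith [mul_le_mul_of_nonneg_left h2 h3]
  have hlog0 : 0 ≤ Real.log x := Real.log_nonneg h1
  have h3 : 0 ≤ (x - 1) ^ 3 := pow_nonneg (by linarith) 3
  have hlogle : Real.log x ≤ (x - 1) - (x - 1) ^ 2 / 2 + c₃ * (x - 1) ^ 3 := by
    nlinarith [hup, hfrac, mul_le_mul_of_nonneg_right hc₃ h3]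
  exact pow_le_pow_left₀ hlog0 hlogle 2

/-- Cells left of the peak, `0 < a ≤ x ≤ 1`:
`(log x)² ≤ ((1−x) + (1−x)²/2 + c₃ (1−x)³)²` for `c₃ ≥ (3−2a)/(3a)`
(`Real.abs_log_sub_add_sum_range_le` with three terms, `(1−x)⁴/x ≤ (1−x)³ (1−a)/a`). [folklore] -/
theorem certHigh2_logsq_minus {x a c₃ : ℝ} (ha : 0 < a) (h1 : a ≤ x) (h2 : x ≤ 1)
    (hc₃ : (3 - 2 * a) / (3 * a) ≤ c₃) :
    Real.log x ^ 2 ≤ ((1 - x) + (1 - x) ^ 2 / 2 + c₃ * (1 - x) ^ 3) ^ 2 := by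
  have hx : 0 < x := by linarith
  have hy : |1 - x| < 1 := by rw [abs_of_nonneg (by linarith)]; linarith
  have h := Real.abs_log_sub_add_sum_range_le hy 3
  simp only [Finset.sum_range_succ, Finset.sum_range_zero] at h
  norm_num at h
  rw [abs_of_nonneg (by linarith : (0 : ℝ) ≤ 1 - x), show (1 : ℝ) - (1 - x) = x by ring] at h
  have hlow := (abs_le.1 h).1
  have hfrac : (1 - x) ^ 4 / x ≤ (1 - a) / a * (1 - x) ^ 3 := by
    rw [div_le_iff₀ hx, div_mul_eq_mul_div, div_mul_eq_mul_div, le_div_iff₀ ha]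
    have h3 : 0 ≤ (1 - x) ^ 3 := pow_nonneg (by linarith) 3
    nlinarith [mul_le_mul_of_nonneg_left h1 h3]
  have hlog0 : 0 ≤ -Real.log x := by linarith [Real.log_nonpos hx.le h2]
  have h3 : 0 ≤ (1 - x) ^ 3 := pow_nonneg (by linarith) 3
  have hlogle : -Real.log x ≤ (1 - x) + (1 - x) ^ 2 / 2 + c₃ * (1 - x) ^ 3 := by
    have h13 : (3 - 2 * a) / (3 * a) = 1 / 3 + (1 - a) / a := by field_simp; ring
    rw [h13] at hc₃
    nlinarith [hlow, hfrac, mul_le_mul_of_nonneg_right hc₃ h3]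
  rw [← neg_sq]
  exact pow_le_pow_left₀ hlog0 hlogle 2

/-- The far-left cell `7/20 ≤ x ≤ 3/5`: `(log x)² ≤ (chord)²` with the chord of the concave `log`
through `(7/20, −53/50)` and `(3/5, −13/25)` (`log (7/20) ≥ −53/50`, `log (3/5) ≥ −13/25`). [folklore] -/
theorem certHigh2_logsq_chord {x : ℝ} (h1 : 7 / 20 ≤ x) (h2 : x ≤ 3 / 5) :
    Real.log x ^ 2 ≤ (-(53 / 50) + 54 / 25 * (x - 7 / 20)) ^ 2 := by
  have hl1 : -(53 / 50) ≤ Real.log (7 / 20) := by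
    rw [Real.le_log_iff_exp_le (by norm_num), Real.exp_neg, inv_le_comm₀ (Real.exp_pos _) (by norm_num)]
    have h := Real.sum_le_exp_of_nonneg (x := 53 / 50) (by norm_num) 6
    simp only [Finset.sum_range_succ, Finset.sum_range_zero, Nat.factorial] at h
    norm_num at h
    linarith
  have hl2 : -(13 / 25) ≤ Real.log (3 / 5) := by
    rw [Real.le_log_iff_exp_le (by norm_num), Real.exp_neg, inv_le_comm₀ (Real.exp_pos _) (by norm_num)]
    have h := Real.sum_le_exp_of_nonneg (x := 13 / 25) (by norm_num) 4
    simp only [Finset.sum_range_succ, Finset.sum_range_zero, Nat.factorial] at h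
    norm_num at h
    linarith
  have hconc := (strictConcaveOn_log_Ioi).concaveOn.2 (show (7 / 20 : ℝ) ∈ Set.Ioi 0 by norm_num)
    (show (3 / 5 : ℝ) ∈ Set.Ioi 0 by norm_num) (show (0 : ℝ) ≤ (3 / 5 - x) * 4 by linarith)
    (show (0 : ℝ) ≤ (x - 7 / 20) * 4 by linarith) (show (3 / 5 - x) * 4 + (x - 7 / 20) * 4 = (1 : ℝ) by ring)
  simp only [smul_eq_mul] at hconc
  rw [show (3 / 5 - x) * 4 * (7 / 20 : ℝ) + (x - 7 / 20) * 4 * (3 / 5) = x by ring] at hconc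
  have hlog0 : 0 ≤ -Real.log x := by linarith [Real.log_nonpos (by linarith) (by linarith : x ≤ 1)]
  have hle : -Real.log x ≤ -(-(53 / 50) + 54 / 25 * (x - 7 / 20)) := by
    nlinarith [mul_le_mul_of_nonneg_left hl1 (by linarith : (0 : ℝ) ≤ (3 / 5 - x) * 4),
      mul_le_mul_of_nonneg_left hl2 (by linarith : (0 : ℝ) ≤ (x - 7 / 20) * 4)]
  rw [← neg_sq, ← neg_sq (-(53 / 50) + 54 / 25 * (x - 7 / 20))]
  exact pow_le_pow_left₀ hlog0 hle 2

/-- The far-right cell `x ≥ 1`: `(log x)² ≤ (x/2 − 3/10)²` (tangent of `log` at `2`, `log 2 ≤ 7/10`).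
[folklore] -/
theorem certHigh2_logsq_tangent {x : ℝ} (h1 : 1 ≤ x) :
    Real.log x ^ 2 ≤ (x / 2 - 3 / 10) ^ 2 := by
  have hx : 0 < x := by linarith
  have hlog0 : 0 ≤ Real.log x := Real.log_nonneg h1
  have h2 : Real.log x = Real.log 2 + Real.log (x / 2) := by
    rw [← Real.log_mul (by norm_num) (by positivity)]; congr 1; ring
  have h3 : Real.log (x / 2) ≤ x / 2 - 1 := Real.log_le_sub_one_of_pos (by positivity)
  have h4 := Real.log_two_lt_d9
  have hle : Real.log x ≤ x / 2 - 3 / 10 := by norm_num at h4; linarith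
  exact pow_le_pow_left₀ hlog0 hle 2

/-- **The height Gaussians from a bound `(log x)² ≤ U`**: with `κ = 3607/10000 ≥ 1/(4 log 2)`,
`1 − κU ≤ E₂(x) = exp(−(log x)²/(4 log 2))` and `1 − 2κU ≤ E₁(x) = exp(−(log x)²/(2 log 2))`
(`1 + y ≤ e^y`). [folklore] -/
theorem certHigh2_E_lower {x U : ℝ} (hU : Real.log x ^ 2 ≤ U) :
    1 - 3607 / 10000 * U ≤ Real.exp (-Real.log x ^ 2 / (4 * Real.log 2)) ∧
      1 - 2 * (3607 / 10000) * U ≤ Real.exp (-Real.log x ^ 2 / (2 * Real.log 2)) := by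
  have hL : (6931471803 : ℝ) / 10000000000 < Real.log 2 := by
    have := Real.log_two_gt_d9; norm_num at this ⊢; linarith
  have hL0 : 0 < Real.log 2 := by linarith
  have ha : Real.log x ^ 2 / (4 * Real.log 2) ≤ 3607 / 10000 * U := by
    rw [div_le_iff₀ (by positivity)]
    nlinarith [sq_nonneg (Real.log x)]
  constructor
  · have h := Real.add_one_le_exp (-Real.log x ^ 2 / (4 * Real.log 2))
    rw [neg_div] at h ⊢
    linarith
  · have h := Real.add_one_le_exp (-Real.log x ^ 2 / (2 * Real.log 2))
    have h2 : Real.log x ^ 2 / (2 * Real.log 2) = 2 * (Real.log x ^ 2 / (4 * Real.log 2)) := by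
      field_simp; ring
    rw [neg_div] at h ⊢
    rw [h2] at h ⊢
    linarith

/-! ### The peak profile `G(x) = x⁴ e^{2−2x²}` against a quadratic on a cell -/

/-- Cells right of the peak (`lo ≥ 1`): if `x⁴ ≤ Ĝ(x) · T₇(2x² − 2)` on the cell (`T₇` the Taylor
polynomial of degree `7`, a lower bound of `e^{2x²−2}`), then `G ≤ Ĝ` there. [folklore] -/
theorem certHigh2_G_le_right {lo hi g₀ g₁ g₂ : ℝ} (hlo : 1 ≤ lo)
    (h : ∀ x : ℝ, lo ≤ x → x ≤ hi → x ^ 4 ≤ (g₀ + g₁ * x + g₂ * x ^ 2) *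
      (1 + (2 * x ^ 2 - 2) + (2 * x ^ 2 - 2) ^ 2 / 2 + (2 * x ^ 2 - 2) ^ 3 / 6 +
        (2 * x ^ 2 - 2) ^ 4 / 24 + (2 * x ^ 2 - 2) ^ 5 / 120 + (2 * x ^ 2 - 2) ^ 6 / 720 +
        (2 * x ^ 2 - 2) ^ 7 / 5040)) :
    ∀ x : ℝ, lo ≤ x → x ≤ hi → x ^ 4 * Real.exp (2 - 2 * x ^ 2) ≤ g₀ + g₁ * x + g₂ * x ^ 2 := by
  intro x h1 h2
  have ht0 : 0 ≤ 2 * x ^ 2 - 2 := by nlinarith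
  have hT := Real.sum_le_exp_of_nonneg ht0 8
  simp only [Finset.sum_range_succ, Finset.sum_range_zero, Nat.factorial] at hT
  norm_num at hT
  have hT1 : 1 ≤ 1 + (2 * x ^ 2 - 2) + (2 * x ^ 2 - 2) ^ 2 / 2 + (2 * x ^ 2 - 2) ^ 3 / 6 +
      (2 * x ^ 2 - 2) ^ 4 / 24 + (2 * x ^ 2 - 2) ^ 5 / 120 + (2 * x ^ 2 - 2) ^ 6 / 720 +
      (2 * x ^ 2 - 2) ^ 7 / 5040 := by
    linarith [pow_nonneg ht0 2, pow_nonneg ht0 3, pow_nonneg ht0 4, pow_nonneg ht0 5, pow_nonneg ht0 6,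
      pow_nonneg ht0 7]
  have hx := h x h1 h2
  have hx4 : 0 ≤ x ^ 4 := by positivity
  have hG0 : 0 ≤ g₀ + g₁ * x + g₂ * x ^ 2 := by
    by_contra hneg
    have hlt : g₀ + g₁ * x + g₂ * x ^ 2 < 0 := lt_of_not_ge hneg
    have hm := mul_le_mul_of_nonpos_left hT1 hlt.le
    linarith
  have key : x ^ 4 ≤ (g₀ + g₁ * x + g₂ * x ^ 2) * Real.exp (2 * x ^ 2 - 2) :=
    hx.trans (mul_le_mul_of_nonneg_left (by linarith) hG0)
  have hinv : Real.exp (2 * x ^ 2 - 2) * Real.exp (2 - 2 * x ^ 2) = 1 := by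
    rw [← Real.exp_add, show 2 * x ^ 2 - 2 + (2 - 2 * x ^ 2) = 0 by ring, Real.exp_zero]
  calc x ^ 4 * Real.exp (2 - 2 * x ^ 2)
      ≤ (g₀ + g₁ * x + g₂ * x ^ 2) * Real.exp (2 * x ^ 2 - 2) * Real.exp (2 - 2 * x ^ 2) :=
        mul_le_mul_of_nonneg_right key (Real.exp_pos _).le
    _ = g₀ + g₁ * x + g₂ * x ^ 2 := by rw [mul_assoc, hinv, mul_one]

/-- Cells left of the peak (`0 ≤ lo`, `hi ≤ 1`): with `a = 1 − x² ∈ [0, 1]`,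
`e^{2−2x²} = (e^a)² ≤ (1 + a + a²/2 + a³/6 + (5/96) a⁴)²` (`Real.exp_bound`), so a polynomial
inequality on the cell gives `G ≤ Ĝ` there. [folklore] -/
theorem certHigh2_G_le_left {lo hi g₀ g₁ g₂ : ℝ} (hlo : 0 ≤ lo) (hhi : hi ≤ 1)
    (h : ∀ x : ℝ, lo ≤ x → x ≤ hi → x ^ 4 * (1 + (1 - x ^ 2) + (1 - x ^ 2) ^ 2 / 2 + (1 - x ^ 2) ^ 3 / 6 +
      5 / 96 * (1 - x ^ 2) ^ 4) ^ 2 ≤ g₀ + g₁ * x + g₂ * x ^ 2) :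
    ∀ x : ℝ, lo ≤ x → x ≤ hi → x ^ 4 * Real.exp (2 - 2 * x ^ 2) ≤ g₀ + g₁ * x + g₂ * x ^ 2 := by
  intro x h1 h2
  have hx0 : 0 ≤ x := hlo.trans h1
  have ha0 : 0 ≤ 1 - x ^ 2 := by nlinarith
  have ha1 : |1 - x ^ 2| ≤ 1 := by rw [abs_of_nonneg ha0]; nlinarith
  have hb := Real.exp_bound ha1 (n := 4) (by norm_num)
  simp only [Finset.sum_range_succ, Finset.sum_range_zero, Nat.factorial] at hb
  norm_num at hb
  rw [abs_of_nonneg ha0] at hb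
  have hup : Real.exp (1 - x ^ 2) ≤ 1 + (1 - x ^ 2) + (1 - x ^ 2) ^ 2 / 2 + (1 - x ^ 2) ^ 3 / 6 +
      5 / 96 * (1 - x ^ 2) ^ 4 := by
    have := (abs_le.1 hb).2; linarith
  have hsq : Real.exp (2 - 2 * x ^ 2) = Real.exp (1 - x ^ 2) ^ 2 := by
    rw [← Real.exp_nat_mul]; congr 1; push_cast; ring
  rw [hsq]
  have h3 := pow_le_pow_left₀ (Real.exp_pos _).le hup 2
  exact (mul_le_mul_of_nonneg_left h3 (by positivity)).trans (h x h1 h2)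

/-! ### One cell of the certificate -/

/-- **Registered helper sub-goal `helper_certHigh2Cell` — assembly of one cell.** On
`[lo, hi] × [−1, 1]`: from `(log x)² ≤ U(x)`, `G ≤ Ĝ = g₀ + g₁x + g₂x²` and the polynomial inequality
`0 ≤ c + w₁ (1 − 2κU) P₁(s) + w₂ (1 − κU) P₂(s) − Ĝ Q₄(bxs)` one gets
`G(x) Q₄(bxs) ≤ c + w₁ E₁(x) P₁(s) + w₂ E₂(x) P₂(s)` (`P₁, P₂ ≥ 0`, `Q₄(bxs) ≥ e^{bxs} > 0` as
`|bxs| ≤ 9/10`). [folklore] -/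
theorem helper_certHigh2Cell : ∀ (b c w₁ w₂ lo hi g₀ g₁ g₂ : ℝ) (U : ℝ → ℝ), 0 ≤ w₁ → 0 ≤ w₂ →
    0 ≤ b → b * hi ≤ 9 / 10 → 0 < lo →
    (∀ x : ℝ, lo ≤ x → x ≤ hi → Real.log x ^ 2 ≤ U x) →
    (∀ x : ℝ, lo ≤ x → x ≤ hi → x ^ 4 * Real.exp (2 - 2 * x ^ 2) ≤ g₀ + g₁ * x + g₂ * x ^ 2) →
    (∀ x s : ℝ, lo ≤ x → x ≤ hi → -1 ≤ s → s ≤ 1 →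
      0 ≤ c + w₁ * (1 - 2 * (3607 / 10000) * U x) *
          (116775 / 131072 + 1235 / 1024 * s + 35455 / 65536 * s ^ 2 + 105 / 1024 * s ^ 3 +
            1155 / 131072 * s ^ 4) +
        w₂ * (1 - 3607 / 10000 * U x) * (51017 / 51200 + 5 / 16 * s + 35 / 2048 * s ^ 2) -
        (g₀ + g₁ * x + g₂ * x ^ 2) *
          (1 + b * x * s + (b * x * s) ^ 2 / 2 + (b * x * s) ^ 3 / 6 + 19 / 375 * (b * x * s) ^ 4)) →
    ∀ x s : ℝ, lo ≤ x → x ≤ hi → -1 ≤ s → s ≤ 1 →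
      x ^ 4 * Real.exp (2 - 2 * x ^ 2) *
          (1 + b * x * s + (b * x * s) ^ 2 / 2 + (b * x * s) ^ 3 / 6 + 19 / 375 * (b * x * s) ^ 4) ≤
        c + w₁ * Real.exp (-Real.log x ^ 2 / (2 * Real.log 2)) *
            (116775 / 131072 + 1235 / 1024 * s + 35455 / 65536 * s ^ 2 + 105 / 1024 * s ^ 3 +
              1155 / 131072 * s ^ 4) +
          w₂ * Real.exp (-Real.log x ^ 2 / (4 * Real.log 2)) *
            (51017 / 51200 + 5 / 16 * s + 35 / 2048 * s ^ 2) := by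
  intro b c w₁ w₂ lo hi g₀ g₁ g₂ U hw₁ hw₂ hb hbhi hlo hU hG hP x s h1 h2 hs1 hs2
  have hx0 : 0 ≤ x := hlo.le.trans h1
  obtain ⟨hE2, hE1⟩ := certHigh2_E_lower (hU x h1 h2)
  have hP1 := certHigh2_P1_nonneg hs1 hs2
  have hP2 : (0 : ℝ) ≤ 51017 / 51200 + 5 / 16 * s + 35 / 2048 * s ^ 2 := by nlinarith
  have habs : |b * x * s| ≤ 9 / 10 := by
    rw [abs_mul, abs_of_nonneg (mul_nonneg hb hx0)]
    have hs : |s| ≤ 1 := abs_le.2 ⟨hs1, hs2⟩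
    have hbx : b * x ≤ 9 / 10 := (mul_le_mul_of_nonneg_left h2 hb).trans hbhi
    nlinarith [mul_le_mul hbx hs (abs_nonneg s) (by norm_num), mul_nonneg hb hx0]
  have hQ : 0 ≤ 1 + b * x * s + (b * x * s) ^ 2 / 2 + (b * x * s) ^ 3 / 6 + 19 / 375 * (b * x * s) ^ 4 :=
    (Real.exp_pos _).le.trans (certHigh2_exp_le_Q4 habs)
  have hGQ := mul_le_mul_of_nonneg_right (hG x h1 h2) hQ
  have hA1 := mul_le_mul_of_nonneg_left (mul_le_mul_of_nonneg_right hE1 hP1) hw₁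
  have hA2 := mul_le_mul_of_nonneg_left (mul_le_mul_of_nonneg_right hE2 hP2) hw₂
  have hp := hP x s h1 h2 hs1 hs2
  nlinarith [hGQ, hA1, hA2, hp]

end Summit.SmoothPoincare4.SmoothPoincare4.Theorems.CylinderEntropySliceIsolation

end
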